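import Summits.NavierStokesRegularity.FluidComputer.PalasekTowerGermHostHorizontal
import Summits.NavierStokesRegularity.FluidComputer.PalasekTowerTinyHosts

/-!
# The germ host, XII: THE FAR PUSHER — an explicit horizontal swirl in the forward cone of `e₃`

Cell `ns-blowup`, seat `ns-blowup-ecbridge-3` (g3); GROUP C «BRIDGE SUPPORT» of the route
`PalasekTowerBreakdown` (crux `EpisodeBaseG`, item stmt-NavierStokesRegularity-19179, R2 of record).
Sequel of `PalasekTowerGermHostHorizontal.lean` (`horizField`, `inner_accel_pos_of_flat_horizontal`);
consumed by `PalasekTowerGermHostStrictTiny.lean` (the first kernel inhabitant of the strict slot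
`LevelZeroData`). LABEL: E–C typing (KERNEL construction: four definitions with body — the centre, the
scalar potential, the pusher, the strict point — and their calculus; everything proved). WHAT THIS IS
NOT: not Navier–Stokes evidence — ONE explicit compactly supported divergence-free test field and
inequalities about it; no profile, flow, stage or schedule is built here.

## The field

* potential `ψ(x) = pusherPot x = (1/8) · etaProf(‖x − 5e₃‖²)` (`etaProf` = ecbridge-4's `C^∞` profile of
  `PalasekTowerTinyBlobProfile.lean`: `1 − 3σ² + 2σ³` near `0`, `0` from `3/2`, derivative `blobG` with
  `|blobG| ≤ 3/2` — `abs_blobG_le`): smooth, `tsupport ψ ⊆ B̄(5e₃, 5/4)`, `∇ψ(x) = (blobG(‖x−5e₃‖²)/4)(x − 5e₃)`,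
  **`‖∇ψ‖ ≤ 15/32`**; points of the support have height `⟪x, e₃⟫ ≥ 15/4`, `‖x‖ ≥ 15/4`;
* pusher `W = farPusher = horizField (Y₀ e₃) ψ = ∇ψ × Y₀e₃` (p451988): smooth, compactly supported,
  divergence free, `⊥ e₃`, `= 0` on `B(0, 15/4)`, **`‖W‖ ≤ (15/32) Y₀ < Y₀`**; on `tsupport ψ` the CONE
  inequality `5⟪0 − x, W x⟫² ≤ ‖0 − x‖²‖W x‖²` (horizontal offset `≤ 5/4` against height `≥ 15/4`) and
  the FORWARD inequality `⟪0 − x, Y₀e₃⟫ ≤ 0`;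
* strict point `x₁ = strictPt = 5e₃ + e₁/2`: `∇ψ(x₁) = −(9/64)e₁`, `W(x₁) = −(9/64)Y₀ · e₁ × e₃`,
  `‖W(x₁)‖ = (9/64)Y₀`, `⟪x₁, W x₁⟫ = 0`, so the forward and cone inequalities are STRICT at `x₁`.

These are exactly the pusher-side hypotheses of `inner_accel_pos_of_flat_horizontal` with `x₀ = 0`,
`e = Y₀e₃`, `r = 1`.

References: A. J. Majda, A. L. Bertozzi, *Vorticity and Incompressible Flow* (CUP 2002), §1.1 (vector
identities `curl(gV₀) = ∇g × V₀`, `div curl = 0`) [cite: MajdaBertozziCUP2002, §1.1 (vector identities)].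
-/

noncomputable section

namespace Summit.NavierStokesRegularity.FluidComputer.PalasekTowerClayBridge.Germ

open Set Function Filter Topology InnerProductSpace Metric MeasureTheory Real
open scoped Topology ContDiff RealInnerProductSpace Laplacian

open Literature.Analysis.FluidPDE TinyBlob

/-! ## §1 The pusher potential `ψ = (1/8) etaProf(‖x − 5e₃‖²)` -/

/-- **The centre of the pusher** `5 e₃`. [folklore] -/
def pusherCenter : EuclideanSpace ℝ (Fin 3) := (5 : ℝ) • e₃

/-- **The pusher potential** `ψ(x) = (1/8) · etaProf(‖x − 5e₃‖²)`. [folklore] -/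
def pusherPot (x : EuclideanSpace ℝ (Fin 3)) : ℝ := 1 / 8 * etaProf (sqn 1 (x - pusherCenter))

/-- `sqn 1 y = ‖y‖²`. [folklore] -/
theorem sqn_one (y : EuclideanSpace ℝ (Fin 3)) : sqn 1 y = ‖y‖ ^ 2 := by simp [sqn]

/-- `⟪5e₃, e₃⟫ = 5`. [folklore] -/
theorem inner_pusherCenter_e₃ : ⟪pusherCenter, e₃⟫ = 5 := by
  rw [pusherCenter, real_inner_smul_left, real_inner_self_eq_norm_sq, norm_e₃]; norm_num

/-- `‖5e₃‖ = 5`. [folklore] -/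
theorem norm_pusherCenter : ‖pusherCenter‖ = 5 := by
  rw [pusherCenter, norm_smul, norm_e₃, Real.norm_eq_abs]; norm_num

/-- `ψ` is smooth. [folklore] -/
theorem contDiff_pusherPot : ContDiff ℝ ∞ pusherPot :=
  contDiff_const.mul (contDiff_etaProf.comp ((contDiff_sqn 1).comp (contDiff_id.sub contDiff_const)))

/-- `ψ` is differentiable. [folklore] -/
theorem differentiable_pusherPot : Differentiable ℝ pusherPot :=
  contDiff_pusherPot.differentiable (by simp)

/-- `|etaProf′| = |blobG| ≤ 3/2` on `[0, ∞)`. [folklore] -/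
theorem abs_blobG_le {σ : ℝ} (hσ : 0 ≤ σ) : |blobG σ| ≤ 3 / 2 := by
  have hm0 := mramp_nonneg hσ
  have hm1 := mramp_le_one σ
  have hj0 := jcut_nonneg σ
  have hj1 := jcut_le_one σ
  have hq : mramp σ * (1 - mramp σ) ≤ 1 / 4 := by nlinarith [sq_nonneg (mramp σ - 1 / 2)]
  have hq0 : 0 ≤ mramp σ * (1 - mramp σ) := mul_nonneg hm0 (by linarith)
  have hprod : mramp σ * (1 - mramp σ) * jcut σ ≤ 1 / 4 * 1 :=
    mul_le_mul hq hj1 hj0 (by norm_num)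
  have hprod0 : 0 ≤ mramp σ * (1 - mramp σ) * jcut σ := mul_nonneg hq0 hj0
  have hG : blobG σ = -6 * (mramp σ * (1 - mramp σ) * jcut σ) := by rw [blobG]; ring
  rw [hG, abs_le]
  constructor <;> linarith

/-- `Dψ(x) = (ψ-coefficient) ⟪x − 5e₃, ·⟫` with coefficient `(1/8) · blobG(‖x − 5e₃‖²) · 2`. [folklore] -/
theorem hasFDerivAt_pusherPot (x : EuclideanSpace ℝ (Fin 3)) :
    HasFDerivAt pusherPot
      ((1 / 8 * blobG (sqn 1 (x - pusherCenter)) * 2) • innerSL ℝ (x - pusherCenter)) x := by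
  have h1 : HasFDerivAt (fun y : EuclideanSpace ℝ (Fin 3) => y - pusherCenter)
      (ContinuousLinearMap.id ℝ _) x := (hasFDerivAt_id x).sub_const pusherCenter
  have h2 := (hasFDerivAt_sqn 1 (x - pusherCenter)).comp x h1
  have h3 := (hasDerivAt_etaProf (sqn 1 (x - pusherCenter))).comp_hasFDerivAt x h2
  have h4 := h3.const_mul (1 / 8)
  have hfun : pusherPot = fun y => 1 / 8 * (etaProf ∘ sqn 1 ∘ fun y => y - pusherCenter) y := rfl
  rw [hfun]
  refine h4.congr_fderiv ?_
  rw [ContinuousLinearMap.comp_id, smul_smul, smul_smul]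
  congr 1
  ring

/-- **The gradient of the potential**: `∇ψ(x) = ((1/8) blobG(‖x − 5e₃‖²) · 2) • (x − 5e₃)`. [folklore] -/
theorem gradient_pusherPot (x : EuclideanSpace ℝ (Fin 3)) :
    gradient pusherPot x = (1 / 8 * blobG (sqn 1 (x - pusherCenter)) * 2) • (x - pusherCenter) := by
  have h := (hasFDerivAt_pusherPot x).fderiv
  refine ext_inner_right ℝ fun v => ?_
  rw [inner_gradient_left, h, real_inner_smul_left]
  rfl

/-- `ψ = 0` where `‖x − 5e₃‖² ≥ 3/2`. [folklore] -/
theorem pusherPot_eq_zero_of_ge {x : EuclideanSpace ℝ (Fin 3)} (h : 3 / 2 ≤ ‖x - pusherCenter‖ ^ 2) :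
    pusherPot x = 0 := by
  rw [pusherPot, sqn_one, etaProf_of_ge h, mul_zero]

/-- `tsupport ψ ⊆ B̄(5e₃, 5/4)`. [folklore] -/
theorem tsupport_pusherPot_subset : tsupport pusherPot ⊆ closedBall pusherCenter (5 / 4) := by
  refine closure_minimal (fun x hx => ?_) isClosed_closedBall
  rw [mem_closedBall, dist_eq_norm]
  by_contra hfar
  push Not at hfar
  refine hx (pusherPot_eq_zero_of_ge ?_)
  nlinarith [norm_nonneg (x - pusherCenter)]

/-- `ψ` has compact support. [folklore] -/
theorem hasCompactSupport_pusherPot : HasCompactSupport pusherPot :=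
  (isCompact_closedBall pusherCenter (5 / 4)).of_isClosed_subset (isClosed_tsupport _)
    tsupport_pusherPot_subset

/-- **`‖∇ψ‖ ≤ 15/32`** everywhere. [folklore] -/
theorem norm_gradient_pusherPot_le (x : EuclideanSpace ℝ (Fin 3)) : ‖gradient pusherPot x‖ ≤ 15 / 32 := by
  rw [gradient_pusherPot, norm_smul, Real.norm_eq_abs]
  set y := x - pusherCenter with hy
  by_cases h : 3 / 2 ≤ ‖y‖ ^ 2
  · rw [sqn_one, blobG_of_ge h]; norm_num
  · push Not at h
    have hyn : ‖y‖ ≤ 5 / 4 := by nlinarith [norm_nonneg y]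
    have hb : |blobG (sqn 1 y)| ≤ 3 / 2 := abs_blobG_le (sqn_nonneg 1 y)
    have hc : |1 / 8 * blobG (sqn 1 y) * 2| ≤ 3 / 8 := by
      rw [abs_mul, abs_mul, abs_of_pos (by norm_num : (0 : ℝ) < 1 / 8),
        abs_of_pos (by norm_num : (0 : ℝ) < 2)]
      linarith
    calc |1 / 8 * blobG (sqn 1 y) * 2| * ‖y‖ ≤ 3 / 8 * (5 / 4) :=
        mul_le_mul hc hyn (norm_nonneg _) (by norm_num)
      _ = 15 / 32 := by norm_num

/-- Points of `tsupport ψ`: `‖x − 5e₃‖ ≤ 5/4`, `⟪x, e₃⟫ ≥ 15/4`, `‖x‖ ≥ 15/4`. [folklore] -/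
theorem geometry_of_mem_tsupport {x : EuclideanSpace ℝ (Fin 3)} (hx : x ∈ tsupport pusherPot) :
    ‖x - pusherCenter‖ ≤ 5 / 4 ∧ 15 / 4 ≤ ⟪x, e₃⟫ ∧ 15 / 4 ≤ ‖x‖ := by
  have h1 : ‖x - pusherCenter‖ ≤ 5 / 4 := by
    have := tsupport_pusherPot_subset hx
    rwa [mem_closedBall, dist_eq_norm] at this
  have h2 : 15 / 4 ≤ ⟪x, e₃⟫ := by
    have hsplit : ⟪x, e₃⟫ = ⟪pusherCenter, e₃⟫ + ⟪x - pusherCenter, e₃⟫ := by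
      rw [← inner_add_left, add_sub_cancel]
    have hle : |⟪x - pusherCenter, e₃⟫| ≤ ‖x - pusherCenter‖ * ‖e₃‖ := abs_real_inner_le_norm _ _
    rw [norm_e₃, mul_one] at hle
    rw [hsplit, inner_pusherCenter_e₃]
    linarith [(abs_le.1 hle).1]
  refine ⟨h1, h2, ?_⟩
  have hle : |⟪x, e₃⟫| ≤ ‖x‖ * ‖e₃‖ := abs_real_inner_le_norm _ _
  rw [norm_e₃, mul_one] at hle
  linarith [(abs_le.1 hle).2]

/-- `0 < 15/4 ≤ ‖x‖` on `tsupport ψ`; contrapositive: `ψ`'s support misses `B(0, 15/4)`. [folklore] -/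
theorem notMem_tsupport_of_norm_lt {x : EuclideanSpace ℝ (Fin 3)} (hx : ‖x‖ < 15 / 4) :
    x ∉ tsupport pusherPot := fun h => by linarith [(geometry_of_mem_tsupport h).2.2]

/-! ## §2 The far pusher `W = ∇ψ × Y₀e₃` -/

/-- **The far pusher** `W = horizField (Y₀ e₃) ψ = ∇ψ × Y₀e₃`. [cite: MajdaBertozziCUP2002, §1.1 (vector identities)] -/
def farPusher : EuclideanSpace ℝ (Fin 3) → EuclideanSpace ℝ (Fin 3) :=
  horizField (TowerRates.wide.Y 0 • e₃) pusherPot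

/-- `tinyProfile a 0 = Y₀ e₃`. [folklore] -/
theorem tinyProfile_zero (a : ℝ) : tinyProfile a 0 = TowerRates.wide.Y 0 • e₃ := by
  show TowerRates.wide.Y 0 • tinyBlob a 0 = _
  rw [tinyBlob_zero]

/-- `W = horizField (U₁(0)) ψ` for the carrier `U₁ = tinyProfile a`. [folklore] -/
theorem farPusher_eq (a : ℝ) : farPusher = horizField (tinyProfile a 0) pusherPot := by
  rw [farPusher, tinyProfile_zero]

/-- `‖Y₀ e₃‖ = Y₀`. [folklore] -/
theorem norm_Y_smul_e₃ : ‖TowerRates.wide.Y 0 • e₃‖ = TowerRates.wide.Y 0 := by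
  rw [norm_smul, norm_e₃, mul_one, Real.norm_eq_abs, abs_of_pos Host.wide_Y_zero_pos]

/-- `W` is smooth. [folklore] -/
theorem contDiff_farPusher : ContDiff ℝ ∞ farPusher := contDiff_horizField contDiff_pusherPot

/-- `W` has compact support. [folklore] -/
theorem hasCompactSupport_farPusher : HasCompactSupport farPusher :=
  hasCompactSupport_horizField hasCompactSupport_pusherPot

/-- `W` is divergence free. [cite: MajdaBertozziCUP2002, §1.1 (vector identities)] -/
theorem isDivFree_farPusher : VectorCalculus.IsDivFree farPusher := isDivFree_horizField contDiff_pusherPot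

/-- `tsupport W ⊆ tsupport ψ`. [folklore] -/
theorem tsupport_farPusher_subset : tsupport farPusher ⊆ tsupport pusherPot := tsupport_horizField_subset

/-- `W = 0` off `tsupport ψ`. [folklore] -/
theorem farPusher_eq_zero {x : EuclideanSpace ℝ (Fin 3)} (hx : x ∉ tsupport pusherPot) : farPusher x = 0 :=
  horizField_eq_zero_of_notMem hx

/-- `W = 0` on `B(0, 15/4)`. [folklore] -/
theorem farPusher_eq_zero_of_norm_lt {x : EuclideanSpace ℝ (Fin 3)} (hx : ‖x‖ < 15 / 4) : farPusher x = 0 :=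
  farPusher_eq_zero (notMem_tsupport_of_norm_lt hx)

/-- **`‖W‖ ≤ (15/32) Y₀`** everywhere. [folklore] -/
theorem norm_farPusher_le (x : EuclideanSpace ℝ (Fin 3)) :
    ‖farPusher x‖ ≤ 15 / 32 * TowerRates.wide.Y 0 := by
  have h := norm_horizField_le (e := TowerRates.wide.Y 0 • e₃) differentiable_pusherPot x
  rw [norm_Y_smul_e₃] at h
  exact h.trans (mul_le_mul_of_nonneg_right (norm_gradient_pusherPot_le x) Host.wide_Y_zero_pos.le)

/-- `‖W‖ < Y₀` everywhere. [folklore] -/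
theorem norm_farPusher_lt (x : EuclideanSpace ℝ (Fin 3)) : ‖farPusher x‖ < TowerRates.wide.Y 0 := by
  have := norm_farPusher_le x
  have hY := Host.wide_Y_zero_pos
  linarith

/-- `W ⊥ e₃` pointwise. [folklore] -/
theorem inner_farPusher_e₃ (x : EuclideanSpace ℝ (Fin 3)) : ⟪farPusher x, e₃⟫ = 0 := by
  have h := inner_horizField (e := TowerRates.wide.Y 0 • e₃) differentiable_pusherPot x
  rw [farPusher]
  rw [real_inner_smul_right] at h
  rcases mul_eq_zero.1 h with h | h
  · exact absurd h Host.wide_Y_zero_pos.ne'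
  · exact h

/-- **The cone inequality on the support**: `5⟪0 − x, W x⟫² ≤ ‖0 − x‖² ‖W x‖²` for `x ∈ tsupport ψ`
(horizontal offset `≤ 5/4`, height `≥ 15/4`, `W ⊥ e₃`). [folklore] -/
theorem cone_farPusher {x : EuclideanSpace ℝ (Fin 3)} (hx : x ∈ tsupport pusherPot) :
    5 * ⟪0 - x, farPusher x⟫ ^ 2 ≤ ‖0 - x‖ ^ 2 * ‖farPusher x‖ ^ 2 := by
  obtain ⟨h1, h2, h3⟩ := geometry_of_mem_tsupport hx
  set d := farPusher x with hd
  have hsplit : ⟪x, d⟫ = ⟪x - pusherCenter, d⟫ + 5 * ⟪e₃, d⟫ := by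
    have hx' : x = (x - pusherCenter) + (5 : ℝ) • e₃ := by rw [pusherCenter]; abel
    conv_lhs => rw [hx']
    rw [inner_add_left, real_inner_smul_left]
  have hperp : ⟪e₃, d⟫ = 0 := by rw [real_inner_comm]; exact inner_farPusher_e₃ x
  rw [hperp, mul_zero, add_zero] at hsplit
  have hcs : |⟪x - pusherCenter, d⟫| ≤ ‖x - pusherCenter‖ * ‖d‖ := abs_real_inner_le_norm _ _
  have hsq : ⟪x - pusherCenter, d⟫ ^ 2 ≤ (5 / 4) ^ 2 * ‖d‖ ^ 2 := by
    have h0 : 0 ≤ ‖x - pusherCenter‖ * ‖d‖ := by positivity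
    have := (sq_le_sq' (by linarith [(abs_le.1 hcs).1]) (abs_le.1 hcs).2)
    calc ⟪x - pusherCenter, d⟫ ^ 2 ≤ (‖x - pusherCenter‖ * ‖d‖) ^ 2 := this
      _ = ‖x - pusherCenter‖ ^ 2 * ‖d‖ ^ 2 := by ring
      _ ≤ (5 / 4) ^ 2 * ‖d‖ ^ 2 := by
          apply mul_le_mul_of_nonneg_right _ (sq_nonneg _)
          exact pow_le_pow_left₀ (norm_nonneg _) h1 2
  have hx2 : (15 / 4 : ℝ) ^ 2 ≤ ‖x‖ ^ 2 := pow_le_pow_left₀ (by norm_num) h3 2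
  rw [zero_sub, inner_neg_left, neg_sq, hsplit, norm_neg]
  nlinarith [sq_nonneg ‖d‖, mul_le_mul_of_nonneg_right hx2 (sq_nonneg ‖d‖)]

/-- **The forward inequality on the support**: `⟪0 − x, Y₀e₃⟫ ≤ 0` for `x ∈ tsupport ψ`. [folklore] -/
theorem forward_farPusher {x : EuclideanSpace ℝ (Fin 3)} (hx : x ∈ tsupport pusherPot) :
    ⟪0 - x, TowerRates.wide.Y 0 • e₃⟫ ≤ 0 := by
  obtain ⟨-, h2, -⟩ := geometry_of_mem_tsupport hx
  rw [zero_sub, inner_neg_left, real_inner_smul_right]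
  have hY := Host.wide_Y_zero_pos
  nlinarith

/-- **The strict point** `x₁ = 5e₃ + e₁/2`. [folklore] -/
def strictPt : EuclideanSpace ℝ (Fin 3) := pusherCenter + (1 / 2 : ℝ) • e₁

/-- `⟪e₁, e₃⟫ = 0`. [folklore] -/
theorem inner_e₁_e₃ : ⟪e₁, e₃⟫ = 0 := by simp [e₁, e₃, EuclideanSpace.inner_single_left]

/-- `∇ψ(x₁) = −(9/64) e₁`. [folklore] -/
theorem gradient_pusherPot_strictPt : gradient pusherPot strictPt = (-(9 / 64) : ℝ) • e₁ := by
  have hsub : strictPt - pusherCenter = (1 / 2 : ℝ) • e₁ := by rw [strictPt]; abel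
  have hsq : sqn 1 ((1 / 2 : ℝ) • e₁) = 1 / 4 := by
    have h1 : ‖e₁‖ = 1 := by simp [e₁]
    rw [sqn_one, norm_smul, h1, Real.norm_eq_abs]; norm_num
  rw [gradient_pusherPot, hsub, hsq, blobG_of_le_half (by norm_num), smul_smul]
  norm_num

/-- `W(x₁) = −(9/64) Y₀ · (e₁ × e₃)`. [folklore] -/
theorem farPusher_strictPt :
    farPusher strictPt = (-(9 / 64) * TowerRates.wide.Y 0 : ℝ) • cross e₁ e₃ := by
  rw [farPusher, horizField_apply (differentiable_pusherPot _), gradient_pusherPot_strictPt,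
    Tao2016.cross_smul_left, Tao2016.cross_smul_right, smul_smul]

/-- `‖e₁ × e₃‖ = 1`. [folklore] -/
theorem norm_cross_e₁_e₃ : ‖cross e₁ e₃‖ = 1 := by
  have h := Tao2016.norm_cross_sq e₁ e₃
  have h1 : ‖e₁‖ = 1 := by simp [e₁]
  rw [h1, norm_e₃, inner_e₁_e₃] at h
  nlinarith [norm_nonneg (cross e₁ e₃)]

/-- `⟪x₁, W x₁⟫ = 0` (the pusher at `x₁` is `∥ e₁ × e₃ ⊥ e₁, e₃`). [folklore] -/
theorem inner_strictPt_farPusher : ⟪strictPt, farPusher strictPt⟫ = 0 := by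
  rw [farPusher_strictPt, real_inner_smul_right, strictPt, pusherCenter, inner_add_left,
    real_inner_smul_left, real_inner_smul_left, Tao2016.inner_self_cross_right,
    Tao2016.inner_self_cross_left]
  ring

/-- `‖W x₁‖ = (9/64) Y₀ > 0`. [folklore] -/
theorem norm_farPusher_strictPt : ‖farPusher strictPt‖ = 9 / 64 * TowerRates.wide.Y 0 := by
  rw [farPusher_strictPt, norm_smul, norm_cross_e₁_e₃, mul_one, Real.norm_eq_abs, abs_mul, abs_neg,
    abs_of_pos (by norm_num : (0 : ℝ) < 9 / 64), abs_of_pos Host.wide_Y_zero_pos]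

/-- `⟪x₁, e₃⟫ = 5`. [folklore] -/
theorem inner_strictPt_e₃ : ⟪strictPt, e₃⟫ = 5 := by
  rw [strictPt, inner_add_left, inner_pusherCenter_e₃, real_inner_smul_left, inner_e₁_e₃]; ring

/-- `‖x₁‖ ≥ 5 > 0`. [folklore] -/
theorem norm_strictPt_ge : 5 ≤ ‖strictPt‖ := by
  have hle : |⟪strictPt, e₃⟫| ≤ ‖strictPt‖ * ‖e₃‖ := abs_real_inner_le_norm _ _
  rw [norm_e₃, mul_one, inner_strictPt_e₃] at hle
  linarith [(abs_le.1 hle).2]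

/-- **The strict forward inequality at `x₁`**: `⟪0 − x₁, Y₀e₃⟫ < 0`. [folklore] -/
theorem forward_strictPt : ⟪0 - strictPt, TowerRates.wide.Y 0 • e₃⟫ < 0 := by
  rw [zero_sub, inner_neg_left, real_inner_smul_right, inner_strictPt_e₃]
  have hY := Host.wide_Y_zero_pos
  nlinarith

/-- **The strict cone inequality at `x₁`**: `5⟪0 − x₁, W x₁⟫² < ‖0 − x₁‖² ‖W x₁‖²`. [folklore] -/
theorem cone_strictPt :
    5 * ⟪0 - strictPt, farPusher strictPt⟫ ^ 2 < ‖0 - strictPt‖ ^ 2 * ‖farPusher strictPt‖ ^ 2 := by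
  rw [zero_sub, inner_neg_left, inner_strictPt_farPusher, neg_zero, norm_neg, norm_farPusher_strictPt]
  have hY := Host.wide_Y_zero_pos
  have hx := norm_strictPt_ge
  have : 0 < ‖strictPt‖ ^ 2 * (9 / 64 * TowerRates.wide.Y 0) ^ 2 := by positivity
  linarith

end Summit.NavierStokesRegularity.FluidComputer.PalasekTowerClayBridge.Germ

end
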